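import Summits.ResolutionOfSingularities.ResolutionOfSingularities.Theorems.FrobeniusLadderFInjectiveMacaulayficationFHalfRowOfTwoStoreysLocal
import Summits.ResolutionOfSingularities.ResolutionOfSingularities.Theorems.FrobeniusLadderFInjectiveMacaulayficationGermFullOfModel
import Mathlib.Algebra.Category.Ring.Instances
import HarnessLib

/-!
# (W-TD) the LOCAL SECOND-STOREY DATUM from an AFFINE MODEL through a local-ring isomorphism (the class row at `P` ⇒ `hfull₂` of `fHalfConclusion_of_localSecondStorey`)
# (crux `FInjectiveMacaulayfication` stmt-ResolutionOfSingularities-15315, chain w45a; res-L1-w45a-plan-1 R21.21 (1) «f4pos_rowD_twoStorey = D-1 + ONE class-row application at P + one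
# local-iso transport»; seat res-L1-w45a-stub-1 g12; sequel of ✓ p664558 / ✓ p664098)

[OURS · L1 W4.5a] Support file (`--supports stmt-ResolutionOfSingularities-15315 --as helper`); def-free; UNCONDITIONAL; no named fact. AI-written (AI review weaker than expert review).

★★ `localSecondStorey_of_affineModel` — `A` a domain, `I ≠ ⊥` an ideal, `Q ∈ Spec A` with `Q ⊆ √I` (so `V(I)` meets the generizations of `Q` only in `Q`; e.g. `I = 𝔪_Q·K′` with
`K′` `𝔪_Q`-primary), `affineBlowup I` FULL at every point (the class row ✓ p656605 on a Σ-refining cover), and an isomorphism of local rings `e : 𝒪_{X₁,P} ≅ 𝒪_{Spec A,Q}`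
(the CI chart presentation at the storey-2 point). THEN the storey-2 datum of ✓ p664558 `fHalfConclusion_of_localSecondStorey` holds at `P`: an ideal sheaf `𝔍 ≠ ⊥` on
`Spec 𝒪_{X₁,P}`, supported at the closed point, ALL of whose blowings up are FULL at every stalk — namely `𝔍 = ε^*(I·𝒪_{Spec A,Q})`, `ε = Spec e⁻¹`.
[cite: GortzWedhorn2020, Prop. 13.91] [cite: StacksProject, Tag 0804 and Tag 01J7]
-/

-- single-problem summit: the doubled namespace component is forced
set_option linter.dupNamespace false

noncomputable section

namespace Summit.ResolutionOfSingularities.ResolutionOfSingularities.Theorems.FInjectiveMacaulayfication.FHalfRowOfTwoStoreys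

open CategoryTheory CategoryTheory.Limits AlgebraicGeometry TopologicalSpace IsLocalRing
open Literature.AlgebraicGeometry.Resolution
open Summit.ResolutionOfSingularities.ResolutionOfSingularities.Theorems.FInjectiveMacaulayfication
open SliceableCentre GermOfGlobalBlowup

/-- ★★ **The local second-storey datum from an affine model through a local-ring isomorphism.** See the module docstring. [folklore transport] -/
theorem localSecondStorey_of_affineModel (p : ℕ) {X₁ : Scheme.{0}} (P : X₁) {A : Type} [CommRing A] [IsDomain A] (I : Ideal A) (hI : I ≠ ⊥)
    (Q : Spec (.of A)) (hIQ : Q.asIdeal ≤ I.radical)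
    (e : X₁.presheaf.stalk P ≅ (Spec (.of A)).presheaf.stalk Q)
    (hfull : ∀ y : ↥(affineBlowup I), FullCl p ((affineBlowup I).presheaf.stalk y)) :
    ∃ 𝔍 : (Spec (X₁.presheaf.stalk P)).IdealSheafData, 𝔍 ≠ ⊥ ∧
      (∀ s ∈ (𝔍.support : Set (Spec (X₁.presheaf.stalk P))), s = closedPoint (X₁.presheaf.stalk P)) ∧
      ∀ (S'' : Scheme.{0}) (g : S'' ⟶ Spec (X₁.presheaf.stalk P)), IsBlowup g 𝔍 → ∀ s : S'', FullCl p (S''.presheaf.stalk s) := by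
  -- the iso of local schemes `ε : Spec 𝒪_{X₁,P} ≅ Spec 𝒪_{Spec A,Q}` and the model's germ centre
  let ε : Spec (X₁.presheaf.stalk P) ≅ Spec ((Spec (.of A)).presheaf.stalk Q) := asIso (Spec.map e.inv)
  let JA : (Spec ((Spec (.of A)).presheaf.stalk Q)).IdealSheafData := (affineBlowup.idealSheaf I).comap ((Spec (.of A)).fromSpecStalk Q)
  have hJA : JA ≠ ⊥ := comap_fromSpecStalk_ne_bot (affineBlowup.idealSheaf_ne_bot hI) Q
  refine ⟨JA.comap ε.hom, ?_, ?_, ?_⟩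
  · -- non-zero
    intro h0
    apply hJA
    have : (JA.comap ε.hom).comap ε.inv = JA := by
      rw [← Scheme.IdealSheafData.comap_comp, Iso.inv_hom_id, Scheme.IdealSheafData.comap_id]
    rw [← this, h0, Scheme.IdealSheafData.comap_bot]
  · -- supported at the closed point
    intro s hs
    rw [Scheme.IdealSheafData.support_comap] at hs
    have hs' : ε.hom s ∈ (JA.support : Set _) := hs
    rw [Scheme.IdealSheafData.support_comap] at hs'
    have hy : (Spec (.of A)).fromSpecStalk Q (ε.hom s) ∈ ((affineBlowup.idealSheaf I).support : Set (Spec (.of A))) := hs'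
    rw [affineBlowup.support_idealSheaf] at hy
    have hIy : I ≤ ((Spec (.of A)).fromSpecStalk Q (ε.hom s)).asIdeal := fun a ha => hy ha
    have hgen : (Spec (.of A)).fromSpecStalk Q (ε.hom s) ⤳ Q := fromSpecStalk_specializes Q _
    have hle : ((Spec (.of A)).fromSpecStalk Q (ε.hom s)).asIdeal ≤ Q.asIdeal := (PrimeSpectrum.le_iff_specializes _ _).mpr hgen
    have hge : Q.asIdeal ≤ ((Spec (.of A)).fromSpecStalk Q (ε.hom s)).asIdeal :=
      hIQ.trans (((Spec (.of A)).fromSpecStalk Q (ε.hom s)).2.radical_le_iff.mpr hIy)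
    have heq : (Spec (.of A)).fromSpecStalk Q (ε.hom s) = Q := PrimeSpectrum.ext (le_antisymm hle hge)
    have hcl : ε.hom s = closedPoint ((Spec (.of A)).presheaf.stalk Q) := eq_closedPoint_of_fromSpecStalk_eq Q _ heq
    -- `ε.hom = Spec.map e.inv` maps only the closed point to the closed point
    haveI : IsLocalHom e.inv.hom := isLocalHom_of_isIso e.inv
    have h2 : ε.hom (closedPoint (X₁.presheaf.stalk P)) = closedPoint ((Spec (.of A)).presheaf.stalk Q) := Spec_closedPoint
    exact (ConcreteCategory.bijective_of_isIso ε.hom.base).1 (hcl.trans h2.symm)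
  · -- every blowing up is FULL: transport along `ε` to a blowing up of `Spec 𝒪_{Spec A,Q}` along `I·𝒪`, FULL by the model (✓ p664098)
    intro S'' g hg s
    have hg' : IsBlowup (g ≫ ε.hom) ((JA.comap ε.hom).comap ε.inv) := hg.comp_iso ε
    have hback : (JA.comap ε.hom).comap ε.inv = JA := by
      rw [← Scheme.IdealSheafData.comap_comp, Iso.inv_hom_id, Scheme.IdealSheafData.comap_id]
    rw [hback] at hg'
    exact GermFullOfModel.forall_isBlowup_germ_fullCl_of_affineBlowup p I Q hfull S'' (g ≫ ε.hom) hg' s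

end Summit.ResolutionOfSingularities.ResolutionOfSingularities.Theorems.FInjectiveMacaulayfication.FHalfRowOfTwoStoreys

end
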